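import Literature.Computability.Complexity.PromiseBPPRelAlmostP
import Literature.Computability.QuantumComplexity.CountingSimulationRelProofs
import Literature.Barriers.PneNP.RelativizationProofs
import Summits.QuantumAdvantage.QuantumAdvantage.Theorems.SoloInformedFloorRelativization
import HarnessLib

/-!
# The classical floor of the door: measure one versus category

Solo seat `solo-QuantumAdvantage-informed`, session 7, file 20; the random-oracle column of the
door table, companion of file 19 (`SoloInformedFloorRelativization`, the generic column) and of the
Literature reproduction `PromiseBPPRelAlmostP` (Bennett–Gill 1981 in promise form:
`∀ᵐ A, PromiseBPP'^A ⊆ promiseLift P^A`).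

The door theory of this seat locates the summit `BQP ⊄ BPP` against the quantum lift
`Q-EXT := PromiseBQP ⊆ promiseLift BQP` and its classical floor — Fortnow's Hypothesis III
`PromiseBPP' ⊆ PromiseP`, the classical lift `C-EXT' := PromiseBPP' ⊆ promiseLift BPP` and
`H₀ := PromiseBPP' ⊆ promiseLift BQP`. File 19 showed that every rung of the floor FAILS at one
oracle `K ⊕ G` (`G` Cohen-generic for a countable family), where moreover `P = BPP = BQP`. This file
records the opposite column and the consequences:

* `aeRelativizes_hypothesisIII`, `aeRelativizes_classicalPromisesLift`, `aeRelativizes_floor`: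
  Hypothesis III, `C-EXT'` and `H₀` (for every presentation of relativised `BQP`) HOLD relative to a
  random oracle (`AERelativizes`, the tree's measure-one technique class).
* `ae_BPPRel_eq_PRel`: Bennett–Gill's `P^A = BPP^A` with probability `1`, in the tree's relativised
  classes, as the trivial-promise instance of the promise theorem.
* `hypothesisIII_contrary`, `classicalPromisesLift_contrary`, `floor_contrary`: NEITHER the floor
  statements NOR their negations relativize (contrary oracles: a random one and `K ⊕ G`); and the
  negations do not even hold relative to a random oracle (`not_aeRelativizes_not_hypothesisIII`).
* `floor_measure_vs_category`: measure and category disagree at the floor — almost every oracle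
  satisfies Hypothesis III, while for EVERY base `B` every `majFamily B`-generic `G` violates it at
  `B ⊕ G` (file 19's base-free stage).
* `ae_doorTable_floor`: the random column of the door table — for almost every `A`:
  `BPP^A = P^A`, Hypothesis III^A, `C-EXT'^A`, `H₀^A`.

What is NOT decided by either column is the quantum rung: `Q-EXT^A := PromiseBQP^A ⊆ promiseLift BQP^A`
fails at `K ⊕ G` (file 19, tree `PromiseLiftRelativization`) but its status relative to a random
oracle is open in both directions (Aaronson–Ambainis territory, `Literature.Barriers.QuantumAdvantage.RandomOracleMethod`).

## References
* [BennettGill1981] C. H. Bennett, J. Gill, *Relative to a random oracle `A`, `P^A ≠ NP^A ≠ co-NP^A`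
  with probability 1*, SIAM J. Comput. 10 (1981), Thm. 5 (`P^A = BPP^A`); via Book–Vollmer–Wagner,
  ICALP 1996, §4 Thm. 3 [corpus: book:editor1996-automata-languages-programming p.417–418].
* [Fortnow2001Derandomization] L. Fortnow, *Comparing notions of full derandomization*, CCC 2001, §2
  (Hypothesis III; its failure relative to Impagliazzo–Naor's generic oracle)
  [corpus: paper:doi-10-1109-ccc-2001-933869 p.3, p.5].
* [Fortnow1994] L. Fortnow, *The role of relativization in complexity theory*, Bull. EATCS 52 (1994), §6
  (random and generic oracles; measure-one statements).
* [AroraBarakCC2009] S. Arora, B. Barak, *Computational Complexity*, CUP 2009, §3.4 and Thm. 3.7 (p. 74).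
-/

noncomputable section

namespace Summit.QuantumAdvantage.QuantumAdvantage.Theorems

open _root_.MeasureTheory _root_.Computability Literature.Computability.Complexity
  Literature.Computability.Complexity.Classes Literature.Computability.Cryptography
  Literature.Computability.QuantumComplexity Literature.Barriers.PneNP
  Literature.Barriers.QuantumAdvantage

/-! ### The floor holds relative to a random oracle -/

/-- **Hypothesis III holds relative to a random oracle**: `O ↦ PromiseBPP'^O ⊆ promiseLift (P^O)` is
in the measure-one technique class. [cite: BennettGill1981, Thm. 5] [cite: Fortnow1994, §6] -/
theorem aeRelativizes_hypothesisIII :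
    AERelativizes fun O => PromiseBPP'Rel O ⊆ promiseLift (PRel O) :=
  promiseBPP'Rel_subset_promiseLift_PRel_ae

/-- **`C-EXT'` holds relative to a random oracle**: `O ↦ PromiseBPP'^O ⊆ promiseLift (BPP^O)`.
[cite: BennettGill1981, Thm. 5] [cite: Goldreich2006, Def. 1.2] -/
theorem aeRelativizes_classicalPromisesLift :
    AERelativizes fun O => PromiseBPP'Rel O ⊆ promiseLift (BPPRel O) :=
  promiseBPP'Rel_subset_promiseLift_BPPRel_ae

/-- **`H₀` holds relative to a random oracle**, for every presentation `C` of relativised `BQP`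
agreeing with `BQPRel` on language oracles (`P^A ⊆ BQP^A`, tree theorem
`PRel_ofLanguage_subset_BQPRel_holds`). [cite: BennettGill1981, Thm. 5] [cite: BernsteinVazirani1997, Thm. 8.2.2 (P ⊆ BQP, relativised)] -/
theorem aeRelativizes_floor {C : Oracle → Set (Language Bool)} (hC : PresentsBQPRel C) :
    AERelativizes fun O => PromiseBPP'Rel O ⊆ promiseLift (C O) := by
  show ∀ᵐ A : Set (List Bool) ∂randomOracleMeasure, _
  filter_upwards [promiseBPP'Rel_subset_promiseLift_PRel_ae] with A hA
  rw [hC A]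
  exact hA.trans (promiseLift_mono (PRel_ofLanguage_subset_BQPRel_holds A))

/-- **Bennett–Gill, `BPP^A ⊆ P^A` with probability `1`**, in the tree's relativised classes — the
trivial-promise instance of the promise theorem (`⟨L, Lᶜ⟩ ∈ PromiseBPP'^A ↔ L ∈ BPP^A`,
`⟨L, Lᶜ⟩ ∈ promiseLift C ↔ L ∈ C`). [cite: BennettGill1981, Thm. 5] -/
theorem ae_BPPRel_subset_PRel :
    ∀ᵐ A : Set (List Bool) ∂randomOracleMeasure,
      BPPRel (Oracle.ofLanguage A) ⊆ PRel (Oracle.ofLanguage A) := by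
  filter_upwards [promiseBPP'Rel_subset_promiseLift_PRel_ae] with A hA
  intro L hL
  exact ofLanguage_mem_promiseLift_iff.1 (hA (ofLanguage_mem_PromiseBPP'Rel_iff.2 hL))

/-- **Bennett–Gill's Theorem 5: `P^A = BPP^A` with probability `1`.** [cite: BennettGill1981, Thm. 5] -/
theorem ae_BPPRel_eq_PRel :
    ∀ᵐ A : Set (List Bool) ∂randomOracleMeasure,
      BPPRel (Oracle.ofLanguage A) = PRel (Oracle.ofLanguage A) := by
  filter_upwards [ae_BPPRel_subset_PRel] with A hA
  exact Set.Subset.antisymm hA (PRel_subset_BPPRel_holds _)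

/-- `O ↦ BPP^O = P^O` (Hypothesis IV relativised) holds relative to a random oracle.
[cite: BennettGill1981, Thm. 5] [cite: Fortnow2001Derandomization, §2 (Hypothesis IV)] -/
theorem aeRelativizes_hypothesisIV : AERelativizes fun O => BPPRel O = PRel O :=
  ae_BPPRel_eq_PRel

/-! ### Two-sided independence: contrary oracles for every rung of the floor -/

/-- **Neither Hypothesis III nor its negation relativizes**: it holds at almost every oracle and
fails at `K ⊕ G` (file 19). [cite: AroraBarakCC2009, Thm. 3.7 and p. 74] [cite: Fortnow2001Derandomization, §2 p. 5] -/
theorem hypothesisIII_contrary :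
    ¬ Relativizes (fun O => PromiseBPP'Rel O ⊆ promiseLift (PRel O)) ∧
      ¬ Relativizes fun O => ¬ (PromiseBPP'Rel O ⊆ promiseLift (PRel O)) := by
  obtain ⟨A, hA⟩ := aeRelativizes_hypothesisIII.exists
  obtain ⟨B, -, -, -, -, -, Q, hQ, -, hnQ, -, -⟩ := exists_oracle_doorTable
  exact not_relativizes_of_contrary A B hA fun h => hnQ (h hQ)

/-- **Neither `C-EXT'` nor its negation relativizes.** [cite: AroraBarakCC2009, Thm. 3.7 and p. 74] [cite: Goldreich2006, Def. 1.2] -/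
theorem classicalPromisesLift_contrary :
    ¬ Relativizes (fun O => PromiseBPP'Rel O ⊆ promiseLift (BPPRel O)) ∧
      ¬ Relativizes fun O => ¬ (PromiseBPP'Rel O ⊆ promiseLift (BPPRel O)) := by
  obtain ⟨A, hA⟩ := aeRelativizes_classicalPromisesLift.exists
  obtain ⟨B, -, -, -, -, -, Q, hQ, -, -, hnQ, -⟩ := exists_oracle_doorTable
  exact not_relativizes_of_contrary A B hA fun h => hnQ (h hQ)

/-- **Neither the floor `H₀` nor its negation relativizes**, for every presentation of relativised
`BQP`. [cite: AroraBarakCC2009, Thm. 3.7 and p. 74] -/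
theorem floor_contrary {C : Oracle → Set (Language Bool)} (hC : PresentsBQPRel C) :
    ¬ Relativizes (fun O => PromiseBPP'Rel O ⊆ promiseLift (C O)) ∧
      ¬ Relativizes fun O => ¬ (PromiseBPP'Rel O ⊆ promiseLift (C O)) := by
  obtain ⟨A, hA⟩ := (aeRelativizes_floor hC).exists
  obtain ⟨B, -, -, -, -, -, Q, hQ, -, -, -, hnQ⟩ := exists_oracle_doorTable
  refine not_relativizes_of_contrary A B hA fun h => hnQ ?_
  have h' : PromiseBPP'Rel (Oracle.ofLanguage B) ⊆ promiseLift (C (Oracle.ofLanguage B)) := h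
  rw [hC B] at h'
  exact h' hQ

/-- The negation of Hypothesis III does not even hold relative to a random oracle (one direction of
the zero-one law made explicit). [cite: Fortnow1994, §6] -/
theorem not_aeRelativizes_not_hypothesisIII :
    ¬ AERelativizes fun O => ¬ (PromiseBPP'Rel O ⊆ promiseLift (PRel O)) :=
  aeRelativizes_hypothesisIII.not_aeRelativizes_not

/-- **Measure versus category at the floor.** Almost every oracle satisfies Hypothesis III, while
for every base `B` and every `majFamily B`-generic `G` it fails at `B ⊕ G` with a tally witness
(file 19). [cite: BennettGill1981, Thm. 5] [cite: Fortnow2001Derandomization, §2 p. 5 ([IN88])] [cite: Fortnow1994, §6] -/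
theorem floor_measure_vs_category :
    (∀ᵐ A : Set (List Bool) ∂randomOracleMeasure,
        PromiseBPP'Rel (Oracle.ofLanguage A) ⊆ promiseLift (PRel (Oracle.ofLanguage A))) ∧
      ∀ B G : Language Bool, IsGeneric (majFamily B) G →
        ¬ (PromiseBPP'Rel (Oracle.ofLanguage (oracleJoin B G)) ⊆
            promiseLift (PRel (Oracle.ofLanguage (oracleJoin B G)))) := by
  refine ⟨promiseBPP'Rel_subset_promiseLift_PRel_ae, fun B G hG h => ?_⟩
  obtain ⟨Q, hQ, -, hnQ⟩ := promiseBPP'Rel_not_subset_promiseLift_PRel_join_of_isGeneric hG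
  exact hnQ (h hQ)

/-! ### The random column of the door table -/

/-- **The door table relative to a random oracle (classical rungs).** For almost every `A`:
`BPP^A = P^A` (Hypothesis IV), `PromiseBPP'^A ⊆ promiseLift P^A` (Hypothesis III),
`PromiseBPP'^A ⊆ promiseLift BPP^A` (`C-EXT'`), `PromiseBPP'^A ⊆ promiseLift BQP^A` (`H₀`). Contrast
`exists_oracle_doorTable` (file 19): at `K ⊕ G` the first holds and the other three fail. The quantum
rung `PromiseBQP^A ⊆ promiseLift BQP^A` is absent: its measure-one status is open.
[cite: BennettGill1981, Thm. 5] [cite: Fortnow2001Derandomization, §2] -/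
theorem ae_doorTable_floor :
    ∀ᵐ A : Set (List Bool) ∂randomOracleMeasure,
      BPPRel (Oracle.ofLanguage A) = PRel (Oracle.ofLanguage A) ∧
        PromiseBPP'Rel (Oracle.ofLanguage A) ⊆ promiseLift (PRel (Oracle.ofLanguage A)) ∧
        PromiseBPP'Rel (Oracle.ofLanguage A) ⊆ promiseLift (BPPRel (Oracle.ofLanguage A)) ∧
        PromiseBPP'Rel (Oracle.ofLanguage A) ⊆ promiseLift (BQPRel A) := by
  filter_upwards [ae_BPPRel_eq_PRel, promiseBPP'Rel_subset_promiseLift_PRel_ae,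
    promiseBPP'Rel_subset_promiseLift_BPPRel_ae,
    show ∀ᵐ A : Set (List Bool) ∂randomOracleMeasure,
        PromiseBPP'Rel (Oracle.ofLanguage A) ⊆ promiseLift (bqpRelOf (Oracle.ofLanguage A)) from
      aeRelativizes_floor presentsBQPRel_bqpRelOf] with A h1 h2 h3 h4
  rw [presentsBQPRel_bqpRelOf A] at h4
  exact ⟨h1, h2, h3, h4⟩

/-- **Summary: the floor is two-sidedly independent of relativizing technique, the quantum rung is
one-sidedly so.** Hypothesis III has contrary oracles; `Q-EXT` fails at some oracle (tree:
`PromiseLiftRelativization`, file 19) — whether it holds at some (or almost every) oracle is open.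
[cite: AroraBarakCC2009, §3.4] [cite: AaronsonAmbainis2014, Thm. 7 (iii)] -/
theorem floor_vs_quantum_rung :
    (¬ Relativizes (fun O => PromiseBPP'Rel O ⊆ promiseLift (PRel O)) ∧
        ¬ Relativizes fun O => ¬ (PromiseBPP'Rel O ⊆ promiseLift (PRel O))) ∧
      ¬ Relativizes fun O => promiseBQPRelOf O ⊆ promiseLift (bqpRelOf O) := by
  refine ⟨hypothesisIII_contrary, fun h => ?_⟩
  obtain ⟨B, -, -, -, -, hnD, -⟩ := exists_oracle_doorTable
  have h' : promiseBQPRelOf (Oracle.ofLanguage B) ⊆ promiseLift (bqpRelOf (Oracle.ofLanguage B)) := h B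
  rw [presentsPromiseBQPRel_promiseBQPRelOf B, presentsBQPRel_bqpRelOf B] at h'
  exact hnD h'

end Summit.QuantumAdvantage.QuantumAdvantage.Theorems

end
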